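import Mathlib
import Literature.Computability.AlgebraicComplexity.AndrewsForbes2022BorderComposition
import Literature.Computability.AlgebraicComplexity.ArithCircuitProofs
import Literature.Barriers.ValiantsHypothesis.BDGIL24AffineInputsVP
import Summits.ValiantsHypothesis.ValiantsHypothesis.Theorems.MonotoneRestorationOrbitRestorationQPDepthThreeRungDefs
import HarnessLib

/-!
# Products of affine forms lie in the `ΣΠΣ` slice `PDClass 1` (ORBIT currency)

Route MonotoneRestoration, crux `OrbitRestorationQP` (stmt-ValiantsHypothesis-18293), line `depth-three-rung`, registered stub
`stub_sigmaPiSigmaKValue` (A_k).  Namespace `Summit.ValiantsHypothesis.ValiantsHypothesis.Theorems.PiSigmaClass`.  Route-independent.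

To feed the `ΠΣ` hypothesis A₁ of the stub with the invariant affine products produced by the structure theorem, each of them must be
placed in the line's class `PDClass (fun _ => 1) n c'`: total degree, Bürgisser complexity and an explicit unbounded-fan-in circuit of
product depth `≤ 1` with polynomially many wires.  This file builds the obvious `ΠΣ` circuit (`piSigmaCircuit`: one affine sum gate
per factor, tree `ArithCircuit.affineGate`, then one product gate) and does the bookkeeping:

* `piSigmaCircuit_eval`, `piSigmaCircuit_productDepth`, `piSigmaCircuit_edgeSize`;
* `complexity_multiset_prod_le`, `complexity_affineProd_le`;
* `pbound_dom` — `(n^c + c)(2n² + 2) ≤ n^(4c+8) + (4c+8)`;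
* `pdClass_one_affineProd` — **a product of at most `n^c + c` affine forms lies in `PDClass 1 n (4c+8)`**.

Everything is proved. [folklore; cite: Burgisser2000, Def. 2.1; LimayeSrinivasanTavenas2021, §1]
-/

noncomputable section

open MvPolynomial Literature.Computability.AlgebraicComplexity

-- `Summit.ValiantsHypothesis.ValiantsHypothesis.…` is the tree's single-conjunct layout (Sub = Summit).
set_option linter.dupNamespace false

namespace Summit.ValiantsHypothesis.ValiantsHypothesis.Theorems

namespace PiSigmaClass

open ArithCircuit

universe u v

variable {k : Type u} [CommSemiring k] {σ : Type v} [Fintype σ] [DecidableEq σ]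

/-! ### The `ΠΣ` circuit of a list of affine forms -/

/-- The `ΠΣ` circuit of a list of affine forms: one affine sum gate per factor, then one product gate. [cite: Burgisser2000, Def. 2.1] -/
def piSigmaCircuit (L : List (MvPolynomial σ k)) : ArithCircuit k σ where
  gates := L.map affineGate ++ [Gate.prod ((List.range L.length).map Operand.gate)]
  output := Operand.gate L.length

/-- The values of the affine prefix are the forms. [folklore] -/
theorem gateValues_affine (L : List (MvPolynomial σ k)) (hL : ∀ q ∈ L, q.totalDegree ≤ 1) :
    gateValues (L.map affineGate) = L := by
  rw [gateValues_eq_map_of_forall (L.map affineGate) (fun g => g.eval []) ?_]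
  · rw [List.map_map]
    conv_rhs => rw [← List.map_id L]
    refine List.map_congr_left fun q hq => ?_
    simp only [Function.comp_apply, id]
    exact eval_affineGate q (hL q hq) []
  · intro g hg vals
    obtain ⟨q, hq, rfl⟩ := List.mem_map.1 hg
    rw [eval_affineGate q (hL q hq), eval_affineGate q (hL q hq)]

omit [Fintype σ] [DecidableEq σ] in
/-- Reading a list back through `getD` over `range`. [folklore] -/
theorem map_getD_range (L : List (MvPolynomial σ k)) : (List.range L.length).map (fun j => L.getD j 0) = L := by
  refine List.ext_getElem (by simp) fun i h1 h2 => ?_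
  simp only [List.getElem_map, List.getElem_range]
  rw [List.getD_eq_getElem _ _ h2]

/-- **The `ΠΣ` circuit computes the product.** [cite: Burgisser2000, Def. 2.1] -/
theorem piSigmaCircuit_eval (L : List (MvPolynomial σ k)) (hL : ∀ q ∈ L, q.totalDegree ≤ 1) :
    (piSigmaCircuit L).eval = L.prod := by
  have hvals : gateValues (piSigmaCircuit L).gates = L ++ [L.prod] := by
    show gateValues (L.map affineGate ++ [Gate.prod ((List.range L.length).map Operand.gate)]) = _
    rw [gateValues_append_singleton, gateValues_affine L hL]
    congr 1
    simp only [Gate.eval, List.map_map, Function.comp_def, Operand.eval]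
    rw [map_getD_range]
  show (piSigmaCircuit L).output.eval (gateValues (piSigmaCircuit L).gates) = L.prod
  rw [hvals]
  show (L ++ [L.prod]).getD L.length 0 = L.prod
  rw [List.getD_eq_getElem _ _ (by simp), List.getElem_append_right (by simp)]
  simp

/-- **The `ΠΣ` circuit has product depth `≤ 1`.** [cite: LimayeSrinivasanTavenas2021, §1] -/
theorem piSigmaCircuit_productDepth (L : List (MvPolynomial σ k)) : (piSigmaCircuit L).productDepth ≤ 1 := by
  unfold productDepth wdepth
  have hpre : gateWDepths (fun g : Gate k σ => if g.isProd then 1 else 0) (L.map affineGate) = List.replicate L.length 0 := by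
    rw [gateWDepths_eq_replicate_of_forall, List.length_map]
    · intro g hg
      obtain ⟨q, -, rfl⟩ := List.mem_map.1 hg
      rw [isProd_affineGate]; rfl
    · intro g hg ds
      obtain ⟨q, -, rfl⟩ := List.mem_map.1 hg
      exact foldr_depthIn_affineGate q ds
  have hall : gateWDepths (fun g : Gate k σ => if g.isProd then 1 else 0) (piSigmaCircuit L).gates =
      List.replicate L.length 0 ++ [1 + (((List.range L.length).map Operand.gate).map
        (Operand.depthIn (k := k) (σ := σ) (List.replicate L.length 0))).foldr max 0] := by
    show gateWDepths _ (L.map affineGate ++ [Gate.prod ((List.range L.length).map Operand.gate)]) = _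
    rw [gateWDepths_append_singleton, hpre]
    rfl
  have hzero' : ∀ l : List ℕ, (∀ j ∈ l, j < L.length) →
      ((l.map Operand.gate).map (Operand.depthIn (k := k) (σ := σ) (List.replicate L.length 0))).foldr max 0 = 0 := by
    intro l hl
    induction l with
    | nil => rfl
    | cons a l ih =>
      rw [List.map_cons, List.map_cons, List.foldr_cons, ih (fun j hj => hl j (by simp [hj]))]
      simp only [Operand.depthIn]
      rw [List.getD_eq_getElem _ _ (by simpa using hl a (by simp))]
      simp
  have hzero := hzero' (List.range L.length) (fun j hj => List.mem_range.1 hj)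
  show (Operand.gate L.length : Operand k σ).depthIn (gateWDepths _ (piSigmaCircuit L).gates) ≤ 1
  rw [hall, hzero, Operand.depthIn, List.getD_eq_getElem _ _ (by simp), List.getElem_append_right (by simp)]
  simp

/-- **The `ΠΣ` circuit has `|L|·(|σ| + 1) + |L|` wires.** [cite: LimayeSrinivasanTavenas2021, §2] -/
theorem piSigmaCircuit_edgeSize (L : List (MvPolynomial σ k)) :
    (piSigmaCircuit L).edgeSize = L.length * (Fintype.card σ + 1) + L.length := by
  unfold edgeSize
  show ((L.map affineGate ++ [Gate.prod ((List.range L.length).map Operand.gate)]).map Gate.fanIn).sum = _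
  rw [List.map_append, List.sum_append, List.map_map]
  have h1 : (L.map (Gate.fanIn ∘ affineGate)).sum = L.length * (Fintype.card σ + 1) := by
    have : L.map (Gate.fanIn ∘ affineGate) = L.map fun _ => Fintype.card σ + 1 :=
      List.map_congr_left fun q _ => by simp [fanIn_affineGate]
    rw [this, List.map_const', List.sum_replicate, smul_eq_mul]
  rw [h1]
  simp [Gate.fanIn, Gate.args]

/-! ### Complexity of affine products -/

omit [Fintype σ] [DecidableEq σ] in
/-- Iterated submultiplicativity of Bürgisser's complexity over a multiset (as in `KaltofenFactorClosureProofs`). [cite: Burgisser2000, Def. 2.1] -/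
theorem complexity_multiset_prod_le {F : Type} [Field F] (s : Multiset (MvPolynomial σ F)) :
    complexity s.prod ≤ (s.map complexity).sum + Multiset.card s := by
  induction s using Multiset.induction_on with
  | empty =>
    rw [Multiset.prod_zero, Multiset.map_zero, Multiset.sum_zero, Multiset.card_zero, ← C_1, complexity_C_holds]
  | cons a s ih =>
    rw [Multiset.prod_cons, Multiset.map_cons, Multiset.sum_cons, Multiset.card_cons]
    calc complexity (a * s.prod) ≤ complexity a + complexity s.prod + 1 := complexity_mul_le_holds _ _
      _ ≤ complexity a + ((s.map complexity).sum + Multiset.card s) + 1 := by gcongr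
      _ = _ := by ring

omit [DecidableEq σ] in
/-- **The complexity of a product of `m` affine forms in `N` variables is `≤ m(2N + 2)`.** [cite: Burgisser2000, Def. 2.1] -/
theorem complexity_affineProd_le (L : Multiset (MvPolynomial σ ℂ)) (hL : ∀ q ∈ L, q.totalDegree ≤ 1) :
    complexity L.prod ≤ Multiset.card L * (2 * Fintype.card σ + 2) := by
  refine (complexity_multiset_prod_le L).trans ?_
  have h : (L.map complexity).sum ≤ (L.map fun _ => 2 * Fintype.card σ + 1).sum :=
    Multiset.sum_map_le_sum_map _ _ fun q hq => Literature.Barriers.ValiantsHypothesis.BergEtAl2024.complexity_le_of_totalDegree_le_one (hL q hq)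
  rw [Multiset.map_const', Multiset.sum_replicate, smul_eq_mul] at h
  calc (L.map complexity).sum + Multiset.card L ≤ Multiset.card L * (2 * Fintype.card σ + 1) + Multiset.card L := by omega
    _ = Multiset.card L * (2 * Fintype.card σ + 2) := by ring

/-! ### The `p`-bound bookkeeping -/

/-- `(n^c + c)(2n² + 2) ≤ n^(4c+8) + (4c+8)`. [folklore] -/
theorem pbound_dom (n c : ℕ) : (n ^ c + c) * (2 * n ^ 2 + 2) ≤ n ^ (4 * c + 8) + (4 * c + 8) := by
  rcases Nat.lt_or_ge n 2 with hn | hn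
  · interval_cases n
    · rcases Nat.eq_zero_or_pos c with rfl | hc
      · norm_num
      · simp [zero_pow hc.ne', zero_pow (show 4 * c + 8 ≠ 0 by omega)]; omega
    · simp only [one_pow, mul_one]; omega
  · have h1 : n ^ c + c ≤ (c + 1) * n ^ c := by
      have : c ≤ c * n ^ c := Nat.le_mul_of_pos_right c (Nat.one_le_pow _ _ (by omega))
      nlinarith
    have h2 : 2 * n ^ 2 + 2 ≤ 4 * n ^ 2 := by nlinarith
    have h3 : c + 1 ≤ 2 ^ c := Nat.lt_two_pow_self
    have h4 : 4 * (c + 1) ≤ n ^ (c + 2) := by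
      calc 4 * (c + 1) ≤ 2 ^ 2 * 2 ^ c := by nlinarith
        _ = 2 ^ (c + 2) := by rw [pow_add]; ring
        _ ≤ n ^ (c + 2) := Nat.pow_le_pow_left hn _
    calc (n ^ c + c) * (2 * n ^ 2 + 2) ≤ ((c + 1) * n ^ c) * (4 * n ^ 2) := Nat.mul_le_mul h1 h2
      _ = 4 * (c + 1) * (n ^ c * n ^ 2) := by ring
      _ ≤ n ^ (c + 2) * (n ^ c * n ^ 2) := Nat.mul_le_mul_right _ h4
      _ = n ^ (2 * c + 4) := by rw [← pow_add, ← pow_add]; ring_nf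
      _ ≤ n ^ (4 * c + 8) := Nat.pow_le_pow_right (by omega) (by omega)
      _ ≤ n ^ (4 * c + 8) + (4 * c + 8) := Nat.le_add_right _ _

/-! ### The class -/

open OrbitRestorationQPDepthThreeRung in
/-- **A product of at most `n^c + c` affine forms on the `n × n` matrix lies in `PDClass 1 n (4c+8)`.**
[cite: LimayeSrinivasanTavenas2021, §1; Burgisser2000, Def. 2.4] -/
theorem pdClass_one_affineProd {n c : ℕ} (L : Multiset (MvPolynomial (Fin n × Fin n) ℂ)) (hL : ∀ q ∈ L, q.totalDegree ≤ 1)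
    (hcard : Multiset.card L ≤ n ^ c + c) : PDClass (fun _ => 1) n (4 * c + 8) L.prod := by
  classical
  have hdom := pbound_dom n c
  have hN : Fintype.card (Fin n × Fin n) = n ^ 2 := by rw [Fintype.card_prod, Fintype.card_fin, sq]
  have hbig : Multiset.card L * (2 * n ^ 2 + 2) ≤ n ^ (4 * c + 8) + (4 * c + 8) := (Nat.mul_le_mul_right _ hcard).trans hdom
  have hone : 1 ≤ 2 * n ^ 2 + 2 := by omega
  refine ⟨?_, ?_, ?_⟩
  · refine (totalDegree_multiset_prod _).trans ?_
    have : (L.map totalDegree).sum ≤ (L.map fun _ => 1).sum := Multiset.sum_map_le_sum_map _ _ hL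
    rw [Multiset.map_const', Multiset.sum_replicate, smul_eq_mul, mul_one] at this
    exact this.trans ((Nat.le_mul_of_pos_right _ hone).trans hbig)
  · refine (complexity_affineProd_le L hL).trans ?_
    rw [hN]; exact hbig
  · refine ⟨piSigmaCircuit L.toList, ?_, piSigmaCircuit_productDepth _, ?_⟩
    · show (piSigmaCircuit L.toList).eval = L.prod
      rw [piSigmaCircuit_eval _ (fun q hq => hL q (Multiset.mem_toList.1 hq)), ← Multiset.prod_coe, Multiset.coe_toList]
    · rw [piSigmaCircuit_edgeSize, Multiset.length_toList, hN]
      exact le_trans (by nlinarith) hbig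

end PiSigmaClass

end Summit.ValiantsHypothesis.ValiantsHypothesis.Theorems

end
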